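import Summits.BirchSwinnertonDyer.BirchSwinnertonDyer.Theorems.ResidualThetaTransportAtTwoResidualSignedLambdaLowerCMAtTwoRhoLayerPairingTower
import Summits.BirchSwinnertonDyer.BirchSwinnertonDyer.Theorems.ResidualThetaTransportAtTwoResidualSignedLambdaLowerCMAtTwoRhoLayerPairingGlueAwayTwo
import Summits.BirchSwinnertonDyer.BirchSwinnertonDyer.Theorems.ResidualThetaTransportAtTwoResidualSignedLambdaLowerCMAtTwoCofreeAdmissible
import Literature.NumberTheory.GaloisRepresentations.ContinuousShapiroLiftCupAdjoint
import Literature.NumberTheory.GaloisRepresentations.ContinuousShapiroOpenCoinducedDescent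
import Literature.AnabelianGeometry.AbsoluteAnabelian.AbsAnabProp121viiLevelCompatProofs
import HarnessLib

/-!
# Sketch (stub-ideation `sidea-stub_cmLambdaLower-1-g18`, k = 1): helper H7 = the `k`-direction (INCLUSION) compatibility
of the `ρ`-coefficient layer Tate pairing values on the `S₀` side of the glue `stub_onePairSupply` (T2(b), GLUE-SPEC-g18),
from LANDED mixed-variance bricks + the tower hypothesis `htower` (⟸ value formula `hePk` + `ζ_{k+1}² = ζ_k`, the extra binder of SUPPLY₂ / OfParts2).

Crux `ResidualThetaCountLowerPureAtTwo` (stmt-26074) ⟵ stub `stub_cmLambdaLower` = RSL_g (stmt-22608), line `onepair` v3a/v3b.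
THEOREMS ONLY about the tree's objects; nothing here proves RSL_g, the crux, or BSD.

* §1 `invAt_cohomologyMap_muLocalIncl` — THE local invariant maps along `μ_{p^k} ⊆ μ_{p^{k+1}}`: `inv^{(p^{k+1})}((ι_μ)_* C) = p · inv^{(p^k)}(C)`
  (exact, in `ℤ/p^{k+1}`; the tree's `Prop121vii.invariantMap_muInclHom_compat` transported along `μ(ℚ̄)| ≅ μ(ℚ̄_v)`; twin of TP2's
  `invAt_cohomologyMap_muLocalPow`, which is the PROJECTION direction and loses one bit).
* §2 generic coefficient modules `f : M → M'` (`[p]`), `ι : M' → M` (inclusion) with ADJOINT carriers `e(a, ι b') = e'(f a, b')`: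
  `layerPairingH1Of_succ_adjoint` — `⟨x, ι_* y⟩_{n,p^{k+1}} = p · ⟨f_* x, y⟩_{n,p^k}` EXACTLY (Literature `shapiroLift_cupProduct_coindFin_map_adjoint` + §1).
* §3 `ρ`: the adjoint carrier identity from a TOWER `e_k([p]a,[p]b) = e_{k+1}(a,b)^p` (`ePk_adjoint_of_tower`), the tower from the value
  formula + compatible roots (`tower_of_values`), and H7 `rhoLayerPairingOf_incl_succ` (pins `red_{p^k} x'`, `layerLocOf_reduce_succ`).
* §4 `p = 2`, the `AwayPins.hlocdS` currency: `addCircle_val_mul_two`, `rhoAwayValue_incl_succ` (= the `(hχt)`-type compatibility the glue of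
  `locdS` over `k` needs), and the converse `AwayPins.value_incl_compat` (H7 on pin classes is NECESSARY: it follows from any `πₐ : AwayPins π`).
-/

set_option autoImplicit false
set_option linter.dupNamespace false

noncomputable section

open scoped Classical

namespace Summit.BirchSwinnertonDyer.BirchSwinnertonDyer.Cruxes.ResidualThetaCountLowerPureAtTwo.SideaK1G18

open CategoryTheory Field NumberField IsDedekindDomain
  Literature.NumberTheory.EllipticCurves Literature.NumberTheory.GaloisRepresentations
  Literature.NumberTheory.EllipticCurves.GreenbergSelmer Literature.NumberTheory.EllipticCurves.CyclotomicLayer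
  Literature.NumberTheory.GaloisCohomology ZpExtension
  Literature.AnabelianGeometry.AbsoluteAnabelian
  Summit.BirchSwinnertonDyer.BirchSwinnertonDyer.Theorems
  Summit.BirchSwinnertonDyer.BirchSwinnertonDyer.Theorems.ThetaTransport
  Summit.BirchSwinnertonDyer.BirchSwinnertonDyer.Theorems.OnePair

attribute [local instance] absoluteGaloisGroup_compactSpace

/-! ## §1 THE local invariant maps along the inclusion `μ_{p^k} ⊆ μ_{p^{k+1}}` -/

section Incl

variable {p : ℕ} [Fact p.Prime] (v : HeightOneSpectrum (𝓞 ℚ)) (k : ℕ)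

/-- `ι_μ : μ_{p^k}|_{Γ_v} ⟶ μ_{p^{k+1}}|_{Γ_v}` (the tree's `muInclHom` restricted to `Γ_v`; twin of TP2's `muLocalPow`). -/
def muLocalIncl : muLocalRep (p ^ k) v ⟶ muLocalRep (p ^ (k + 1)) v :=
  TopRep.ofHom ((muInclHom ℚ (pow_dvd_pow p (Nat.le_succ k))).hom.restrictField (v.adicCompletion ℚ))

omit [Fact p.Prime] in
/-- Values of `muLocalIncl`: the identity on underlying units. -/
@[simp] theorem muVal_muLocalIncl (x : DiscreteGaloisModule.MuCarrier ℚ (p ^ k)) :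
    muVal ℚ (p ^ (k + 1)) ((muLocalIncl v k).hom x) = muVal ℚ (p ^ k) x := rfl

/-- **H2. THE invariant maps along `ι_μ`**: `inv^{(p^{k+1})}((ι_μ)_* C) = p · inv^{(p^k)}(C)` in `ℤ/p^{k+1}` (exact — no bit is lost). -/
theorem invAt_cohomologyMap_muLocalIncl (C : continuousCohomology 2 (muLocalRep (p ^ k) v)) :
    haveI : NeZero (p ^ k) := ⟨pow_ne_zero k (Fact.out : p.Prime).ne_zero⟩
    haveI : NeZero (p ^ (k + 1)) := ⟨pow_ne_zero (k + 1) (Fact.out : p.Prime).ne_zero⟩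
    invAt (p ^ (k + 1)) v (cohomologyMap (muLocalIncl v k) 2 C) = (((invAt (p ^ k) v C).val * p : ℕ) : ZMod (p ^ (k + 1))) := by
  haveI : NeZero (p ^ k) := ⟨pow_ne_zero k (Fact.out : p.Prime).ne_zero⟩
  haveI : NeZero (p ^ (k + 1)) := ⟨pow_ne_zero (k + 1) (Fact.out : p.Prime).ne_zero⟩
  have hd : p ^ k ∣ p ^ (k + 1) := pow_dvd_pow p (Nat.le_succ k)
  -- swap `μ(ℚ̄)| ≅ μ(ℚ̄_v)` and the inclusions BEFORE `CharZero ℚ_v` is in context (as in TP2's `invAt_cohomologyMap_muLocalPow`)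
  have hpt : ∀ x : DiscreteGaloisModule.MuCarrier ℚ (p ^ k),
      (resIdHom (muLocalIncl v k ≫ (muLocalIso v (p ^ (k + 1))).hom)).hom x =
        (resIdHom (muInclHom (v.adicCompletion ℚ) hd)).hom ((resIdHom (muLocalIso v (p ^ k)).hom).hom x) := fun x => by
    apply muVal_injective (v.adicCompletion ℚ) (p ^ (k + 1))
    change muVal (v.adicCompletion ℚ) (p ^ (k + 1)) (muTransfer ℚ (v.adicCompletion ℚ) (p ^ (k + 1))
        (muInclusion ℚ hd x)) =
      muVal (v.adicCompletion ℚ) (p ^ (k + 1)) (muInclusion (v.adicCompletion ℚ) hd (muTransfer ℚ (v.adicCompletion ℚ) (p ^ k) x))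
    rw [muVal_muTransfer, muVal_muInclusion, muVal_muInclusion, muVal_muTransfer]
  have h1 := map_comp_apply_of (ContinuousMonoidHom.id _) (ContinuousMonoidHom.id _) (ContinuousMonoidHom.id _) (fun _ => rfl)
    (resIdHom (muLocalIncl v k)) (resIdHom (muLocalIso v (p ^ (k + 1))).hom)
    (resIdHom (muLocalIncl v k ≫ (muLocalIso v (p ^ (k + 1))).hom)) (fun _ => rfl) 2 C
  have h2 := map_comp_apply_of (ContinuousMonoidHom.id _) (ContinuousMonoidHom.id _) (ContinuousMonoidHom.id _) (fun _ => rfl)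
    (resIdHom (muLocalIso v (p ^ k)).hom) (resIdHom (muInclHom (v.adicCompletion ℚ) hd))
    (resIdHom (muLocalIncl v k ≫ (muLocalIso v (p ^ (k + 1))).hom)) hpt 2 C
  have hswap : (cohomologyMap (muLocalIso v (p ^ (k + 1))).hom 2).hom (cohomologyMap (muLocalIncl v k) 2 C) =
      cohomologyMap (muInclHom (v.adicCompletion ℚ) hd) 2 ((cohomologyMap (muLocalIso v (p ^ k)).hom 2).hom C) :=
    h1.symm.trans h2
  have hq : p ^ (k + 1) / p ^ k = p := by
    rw [pow_succ, Nat.mul_div_cancel_left p (pow_pos (Fact.out : p.Prime).pos k)]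
  haveI : CharZero (v.adicCompletion ℚ) := charZero_adicCompletion v
  unfold invAt localInvariantMap
  change Prop121vii.invLevel (v.adicCompletion ℚ) (p ^ (k + 1))
      ((cohomologyMap (muLocalIso v (p ^ (k + 1))).hom 2).hom (cohomologyMap (muLocalIncl v k) 2 C)) =
    (((Prop121vii.invLevel (v.adicCompletion ℚ) (p ^ k) ((cohomologyMap (muLocalIso v (p ^ k)).hom 2).hom C)).val * p : ℕ) :
      ZMod (p ^ (k + 1)))
  rw [hswap, Prop121vii.invariantMap_muInclHom_compat (v.adicCompletion ℚ) hd _ _ (Prop121vii.isInvariantMap_invLevel _ (p ^ k))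
    (Prop121vii.isInvariantMap_invLevel _ (p ^ (k + 1))), hq]

end Incl

/-! ## §2 Generic coefficients, ADJOINT carriers: `⟨x, ι_* y⟩_{n,p^{k+1}} = p · ⟨f_* x, y⟩_{n,p^k}` -/

section Generic

variable {p : ℕ} [Fact p.Prime] (k : ℕ) {M M' : Type} [AddCommGroup M] [TopologicalSpace M] [DiscreteTopology M]
  [AddCommGroup M'] [TopologicalSpace M'] [DiscreteTopology M']
  (ρM : DiscreteGaloisModule ℚ M) (ρM' : DiscreteGaloisModule ℚ M') (f : ρM.toTopRep ⟶ ρM'.toTopRep) (ι : ρM'.toTopRep ⟶ ρM.toTopRep)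
  (e : M → M → AlgebraicClosure ℚ)
  (hμ : ∀ S T, e S T ^ (p ^ (k + 1)) = 1)
  (hadd₁ : ∀ S₁ S₂ T, e (S₁ + S₂) T = e S₁ T * e S₂ T)
  (hadd₂ : ∀ S T₁ T₂, e S (T₁ + T₂) = e S T₁ * e S T₂)
  (hgal : ∀ (σ : absoluteGaloisGroup ℚ) (S T : M), σ • e S T = e (ρM σ S) (ρM σ T))
  (e' : M' → M' → AlgebraicClosure ℚ)
  (hμ' : ∀ S T, e' S T ^ (p ^ k) = 1)
  (hadd₁' : ∀ S₁ S₂ T, e' (S₁ + S₂) T = e' S₁ T * e' S₂ T)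
  (hadd₂' : ∀ S T₁ T₂, e' S (T₁ + T₂) = e' S T₁ * e' S T₂)
  (hgal' : ∀ (σ : absoluteGaloisGroup ℚ) (S T : M'), σ • e' S T = e' (ρM' σ S) (ρM' σ T))
  (hadj : ∀ (a : M) (b' : M'), e a (ι.hom b') = e' (f.hom a) b')
  (κ : ZpExtension ℚ p) (v : HeightOneSpectrum (𝓞 ℚ))

include hadj in
/-- **H5′. The adjoint carrier identity on `μ`**: `ι_μ ⟨f a, b'⟩' = ⟨a, ι b'⟩` (the hypothesis `hc` of `shapiroLift_cupProduct_coindFin_map_adjoint`). -/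
theorem muLocalIncl_localPairingOfFun (a : M) (b' : M') :
    haveI : NeZero (p ^ k) := ⟨pow_ne_zero k (Fact.out : p.Prime).ne_zero⟩
    haveI : NeZero (p ^ (k + 1)) := ⟨pow_ne_zero (k + 1) (Fact.out : p.Prime).ne_zero⟩
    (muLocalIncl v k).hom ((localPairingOfFun ρM' (p ^ k) e' hμ' hadd₁' hadd₂' hgal' v).toLin
        ((TopRep.ofHom (f.hom.restrictField (v.adicCompletion ℚ)) : localRepOf ρM v ⟶ localRepOf ρM' v).hom a) b') =
      (localPairingOfFun ρM (p ^ (k + 1)) e hμ hadd₁ hadd₂ hgal v).toLin a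
        ((TopRep.ofHom (ι.hom.restrictField (v.adicCompletion ℚ)) : localRepOf ρM' v ⟶ localRepOf ρM v).hom b') := by
  haveI : NeZero (p ^ k) := ⟨pow_ne_zero k (Fact.out : p.Prime).ne_zero⟩
  haveI : NeZero (p ^ (k + 1)) := ⟨pow_ne_zero (k + 1) (Fact.out : p.Prime).ne_zero⟩
  apply muVal_injective ℚ (p ^ (k + 1))
  change muVal ℚ (p ^ (k + 1)) (muInclusion ℚ (pow_dvd_pow p (Nat.le_succ k)) (pairingHomOfFun (p ^ k) e' hμ' hadd₁' hadd₂' (f.hom a) b')) =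
    muVal ℚ (p ^ (k + 1)) (pairingHomOfFun (p ^ (k + 1)) e hμ hadd₁ hadd₂ a (ι.hom b'))
  rw [muVal_muInclusion]
  apply Units.ext
  exact (hadj a b').symm

include hadj in
/-- **H1. Level compatibility of the two-argument layer pairings along the INCLUSION** (`M' → M`, `p^k → p^{k+1}`), exact in `ℤ/p^{k+1}`:
`⟨x, ι_* y⟩_{n,p^{k+1}} = p · ⟨f_* x, y⟩_{n,p^k}` on `H¹(U_n, M|) × H¹(U_n, M'|)` — squares: Shapiro (coefficients), the MIXED-VARIANCE cup product
(`shapiroLift_cupProduct_coindFin_map_adjoint`), THE invariant maps along `ι_μ` (§1). -/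
theorem layerPairingH1Of_succ_adjoint (n : ℕ) (x : continuousCohomology 1 (subgroupRep (localRepOf ρM v) (layerGroup κ v n)))
    (y : continuousCohomology 1 (subgroupRep (localRepOf ρM' v) (layerGroup κ v n))) :
    haveI : NeZero (p ^ k) := ⟨pow_ne_zero k (Fact.out : p.Prime).ne_zero⟩
    haveI : NeZero (p ^ (k + 1)) := ⟨pow_ne_zero (k + 1) (Fact.out : p.Prime).ne_zero⟩
    layerPairingH1Of ρM (p ^ (k + 1)) e hμ hadd₁ hadd₂ hgal κ v n x
        (cohomologyMap (subgroupRepMap (Y := localRepOf ρM v) (TopRep.ofHom (ι.hom.restrictField (v.adicCompletion ℚ))) (layerGroup κ v n)) 1 y) =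
      (((layerPairingH1Of ρM' (p ^ k) e' hμ' hadd₁' hadd₂' hgal' κ v n
        (cohomologyMap (subgroupRepMap (Y := localRepOf ρM' v) (TopRep.ofHom (f.hom.restrictField (v.adicCompletion ℚ))) (layerGroup κ v n)) 1 x)
        y).val * p : ℕ) : ZMod (p ^ (k + 1))) := by
  haveI : NeZero (p ^ k) := ⟨pow_ne_zero k (Fact.out : p.Prime).ne_zero⟩
  haveI : NeZero (p ^ (k + 1)) := ⟨pow_ne_zero (k + 1) (Fact.out : p.Prime).ne_zero⟩
  letI : Fintype (absoluteGaloisGroup (v.adicCompletion ℚ) ⧸ layerGroup κ v n) := layerFintypeQuot κ v n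
  rw [layerPairingH1Of_apply, layerPairingH1Of_apply, ← invAt_cohomologyMap_muLocalIncl v k]
  congr 1
  unfold layerShapiroOf layerSumPairingOf
  exact (shapiroLift_cupProduct_coindFin_map_adjoint _ _
    ((TopRep.ofHom (f.hom.restrictField (v.adicCompletion ℚ)) : localRepOf ρM v ⟶ localRepOf ρM' v))
    ((TopRep.ofHom (ι.hom.restrictField (v.adicCompletion ℚ)) : localRepOf ρM' v ⟶ localRepOf ρM v))
    (muLocalIncl v k) (layerGroup κ v n) (isOpen_layerGroup κ v n) (layerReps_spec κ v n) (layerReps_one κ v n)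
    (fun a b' => muLocalIncl_localPairingOfFun k ρM ρM' f ι e hμ hadd₁ hadd₂ hgal e' hμ' hadd₁' hadd₂' hgal' hadj v a b') x y).symm

omit [TopologicalSpace M] [DiscreteTopology M] in
/-- `e(a, n • b) = e(a, b)^n` for a pairing multiplicative on the right with values of finite order. [folklore] -/
theorem pairing_nsmul_right {N : ℕ} [NeZero N] (e : M → M → AlgebraicClosure ℚ) (hμ : ∀ S T, e S T ^ N = 1)
    (hadd₂ : ∀ S T₁ T₂, e S (T₁ + T₂) = e S T₁ * e S T₂) (a : M) : ∀ (n : ℕ) (b : M), e a (n • b) = e a b ^ n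
  | 0, b => by
    have h := hadd₂ a 0 0
    rw [add_zero] at h
    have hne : e a 0 ≠ 0 := fun h0 => by
      have h1 := hμ a 0
      rw [h0, zero_pow (NeZero.ne N)] at h1
      exact zero_ne_one h1
    rw [zero_nsmul, pow_zero]
    exact (mul_right_cancel₀ hne ((one_mul _).trans h)).symm
  | n + 1, b => by rw [succ_nsmul, hadd₂, pairing_nsmul_right e hμ hadd₂ a n b, pow_succ]

end Generic

/-! ## §3 `ρ`: the adjoint carriers from the TOWER, the tower from the values, and H7 -/

section Rho

variable {p : ℕ} [Fact p.Prime] (S : Set (PadicAlgCl p)) {d : ℕ} (ρ : FramedGaloisRep ℚ ↥(padicCoeffIntegers S) d)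
  (ePk : ∀ k : ℕ, ↥(AddSubgroup.torsionBy (Cofree ρ ↥(padicCoeffField S)) ((p ^ k : ℕ) : ℤ)) →
    ↥(AddSubgroup.torsionBy (Cofree ρ ↥(padicCoeffField S)) ((p ^ k : ℕ) : ℤ)) → AlgebraicClosure ℚ)
  (hμPk : ∀ k a b, ePk k a b ^ (p ^ k) = 1)
  (hadd₁Pk : ∀ k a₁ a₂ b, ePk k (a₁ + a₂) b = ePk k a₁ b * ePk k a₂ b)
  (hadd₂Pk : ∀ k a b₁ b₂, ePk k a (b₁ + b₂) = ePk k a b₁ * ePk k a b₂)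
  (hgalPk : ∀ k (σ : absoluteGaloisGroup ℚ) (a b : ↥(AddSubgroup.torsionBy (Cofree ρ ↥(padicCoeffField S)) ((p ^ k : ℕ) : ℤ))),
    σ • ePk k a b = ePk k (cofreeTorsionGaloisModule S ρ _ σ a) (cofreeTorsionGaloisModule S ρ _ σ b))
  (htower : ∀ k (a b : ↥(AddSubgroup.torsionBy (Cofree ρ ↥(padicCoeffField S)) ((p ^ (k + 1) : ℕ) : ℤ))),
    ePk k ((cofreeTorsionPow S ρ k).hom a) ((cofreeTorsionPow S ρ k).hom b) = ePk (k + 1) a b ^ p)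
  (κ : ZpExtension ℚ p) (v : HeightOneSpectrum (𝓞 ℚ)) (k : ℕ)
  (ι : (cofreeTorsionGaloisModule S ρ ((p ^ k : ℕ) : ℤ)).toTopRep ⟶ (cofreeTorsionGaloisModule S ρ ((p ^ (k + 1) : ℕ) : ℤ)).toTopRep)
  (hι : ∀ b, ((ι.hom b : ↥(AddSubgroup.torsionBy (Cofree ρ ↥(padicCoeffField S)) ((p ^ (k + 1) : ℕ) : ℤ))) : Cofree ρ ↥(padicCoeffField S)) =
    (b : Cofree ρ ↥(padicCoeffField S)))

/-- `a ∈ A_ρ[p^k] ⟹ a ∈ A_ρ[p^{k+1}]` — the membership half of the level-raising inclusion `ι : A_ρ[p^k] ⟶ A_ρ[p^{k+1}]` (the def itself =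
mirror of `cofreeTorsionPow` with this lemma in place of `zsmul_mem_cofreeTorsionBy_pow`; the theorems below take `ι` as a binder with its value
formula `hι`, so they apply to whichever def the glue file adopts). [cite: Kato2004Asterisque, §13.8 (p. 228)] -/
theorem mem_cofreeTorsionBy_succ (a : ↥(AddSubgroup.torsionBy (Cofree ρ ↥(padicCoeffField S)) ((p ^ k : ℕ) : ℤ))) :
    (a : Cofree ρ ↥(padicCoeffField S)) ∈ AddSubgroup.torsionBy (Cofree ρ ↥(padicCoeffField S)) ((p ^ (k + 1) : ℕ) : ℤ) := by
  refine (Submodule.mem_torsionBy_iff (R := ℤ) _ _).mpr ?_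
  have h : ((p ^ (k + 1) : ℕ) : ℤ) = (p : ℤ) * ((p ^ k : ℕ) : ℤ) := by push_cast; ring
  rw [h, mul_smul, (Submodule.mem_torsionBy_iff (R := ℤ) _ _).mp a.2, smul_zero]

include hμPk hadd₂Pk htower hι in
/-- **H5. The ADJOINT carrier identity from the tower**: `e_{k+1}(a, ι b') = e_k([p] a, b')` — write `b' = [p] b` (`[p]` is onto `A_ρ[p^k]`,
`divPowCofreeMkTorsion_surjective`), so `ι b' = p • b` and `e_{k+1}(a, p • b) = e_{k+1}(a, b)^p = e_k([p]a, [p]b)`. -/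
theorem ePk_adjoint_of_tower (a : ↥(AddSubgroup.torsionBy (Cofree ρ ↥(padicCoeffField S)) ((p ^ (k + 1) : ℕ) : ℤ)))
    (b' : ↥(AddSubgroup.torsionBy (Cofree ρ ↥(padicCoeffField S)) ((p ^ k : ℕ) : ℤ))) :
    ePk (k + 1) a (ι.hom b') = ePk k ((cofreeTorsionPow S ρ k).hom a) b' := by
  haveI : NeZero (p ^ (k + 1)) := ⟨pow_ne_zero (k + 1) (Fact.out : p.Prime).ne_zero⟩
  obtain ⟨t, rfl⟩ := divPowCofreeMkTorsion_surjective S ρ k b'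
  have hb : ι.hom (divPowCofreeMkTorsion S ρ k t) = p • divPowCofreeMkTorsion S ρ (k + 1) t := by
    apply Subtype.ext
    rw [hι, ← cofreeTorsionPow_divPowCofreeMkTorsion S ρ k t, coe_cofreeTorsionPow_apply, AddSubgroupClass.coe_nsmul, natCast_zsmul]
  rw [hb, pairing_nsmul_right (ePk (k + 1)) (hμPk (k + 1)) (hadd₂Pk (k + 1)) a p, ← htower, cofreeTorsionPow_divPowCofreeMkTorsion]

set_option maxHeartbeats 3200000 in
-- the rewrite `layerLocOf_reduce_succ` at the concrete torsion module is slow to unify (cf. the note in `…RhoLayerPairingCompat`)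
include hμPk hadd₂Pk htower hι in
/-- **H7 (strong `ℤ/p^{k+1}` form). The `k`-direction INCLUSION compatibility of the `ρ`-coefficient layer pairing values with a PIN as first
argument**: for `x' ∈ H¹(Γ_n, T_ρ)` and a local class `y ∈ H¹(U_{n,v}, A_ρ[p^k]|)`,
`⟨loc red_{p^{k+1}} x', ι_* y⟩_{n,p^{k+1}} = p · ⟨loc red_{p^k} x', y⟩_{n,p^k}` — `loc red_{p^k} x' = [p]_* loc red_{p^{k+1}} x'` (`layerLocOf_reduce_succ`) + §2. -/
theorem rhoLayerPairingOf_incl_succ (n : ℕ) (x' : H1 (FramedGaloisRep.toGaloisRep ρ) (κ.layerSubgroup n))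
    (y : continuousCohomology 1 (subgroupRep (localRepOf (cofreeTorsionGaloisModule S ρ ((p ^ k : ℕ) : ℤ)) v) (layerGroup κ v n))) :
    haveI : NeZero (p ^ k) := ⟨pow_ne_zero k (Fact.out : p.Prime).ne_zero⟩
    haveI : NeZero (p ^ (k + 1)) := ⟨pow_ne_zero (k + 1) (Fact.out : p.Prime).ne_zero⟩
    layerPairingOf (cofreeTorsionGaloisModule S ρ ((p ^ (k + 1) : ℕ) : ℤ)) (p ^ (k + 1)) (ePk (k + 1)) (hμPk (k + 1)) (hadd₁Pk (k + 1))
        (hadd₂Pk (k + 1)) (hgalPk (k + 1)) κ v n (reduceH1CofreePkTorsion S ρ (k + 1) (κ.layerSubgroup n) x')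
        (cohomologyMap (subgroupRepMap (Y := localRepOf (cofreeTorsionGaloisModule S ρ ((p ^ (k + 1) : ℕ) : ℤ)) v)
          (TopRep.ofHom (ι.hom.restrictField (v.adicCompletion ℚ))) (layerGroup κ v n)) 1 y) =
      (((layerPairingOf (cofreeTorsionGaloisModule S ρ ((p ^ k : ℕ) : ℤ)) (p ^ k) (ePk k) (hμPk k) (hadd₁Pk k) (hadd₂Pk k) (hgalPk k) κ v n
        (reduceH1CofreePkTorsion S ρ k (κ.layerSubgroup n) x') y).val * p : ℕ) : ZMod (p ^ (k + 1))) := by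
  haveI : NeZero (p ^ k) := ⟨pow_ne_zero k (Fact.out : p.Prime).ne_zero⟩
  haveI : NeZero (p ^ (k + 1)) := ⟨pow_ne_zero (k + 1) (Fact.out : p.Prime).ne_zero⟩
  have hloc := layerLocOf_reduce_succ S ρ k v κ n x'
  have H := layerPairingH1Of_succ_adjoint k (cofreeTorsionGaloisModule S ρ ((p ^ (k + 1) : ℕ) : ℤ))
    (cofreeTorsionGaloisModule S ρ ((p ^ k : ℕ) : ℤ)) (cofreeTorsionPow S ρ k) ι (ePk (k + 1)) (hμPk (k + 1)) (hadd₁Pk (k + 1))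
    (hadd₂Pk (k + 1)) (hgalPk (k + 1)) (ePk k) (hμPk k) (hadd₁Pk k) (hadd₂Pk k) (hgalPk k)
    (fun a b' => ePk_adjoint_of_tower S ρ ePk hμPk hadd₂Pk htower k ι hι a b') κ v n
    (layerLocOf (cofreeTorsionGaloisModule S ρ ((p ^ (k + 1) : ℕ) : ℤ)) κ v n (reduceH1CofreePkTorsion S ρ (k + 1) (κ.layerSubgroup n) x')) y
  rw [layerPairingOf_apply, layerPairingOf_apply, hloc]
  exact H

/-- **H6. The TOWER from the value formula and COMPATIBLE primitive roots** (`ζ_{k+1}^p = ζ_k`, the extra binder of SUPPLY₂ / `…OfParts2`):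
`e_k([p]a, [p]b) = e_{k+1}(a, b)^p` — on representatives `p^{-k-1}s`: `(ζ_{k+1}^{w_{k+1}})^p = ζ_k^{w_{k+1}} = ζ_k^{w_k}` (`w_{k+1} ≡ w_k mod p^k`). -/
theorem tower_of_values (ζ : ℕ → AlgebraicClosure ℚ) (hζ : ∀ k, IsPrimitiveRoot (ζ k) (p ^ k)) (hζsucc : ∀ k, ζ (k + 1) ^ p = ζ k)
    (w : (Fin d → ↥(padicCoeffIntegers S)) → (Fin d → ↥(padicCoeffIntegers S)) → ℤ_[p])
    (hePk : ∀ k (s t : Fin d → ↥(padicCoeffIntegers S)),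
      ePk k (divPowCofreeMkTorsion S ρ k s) (divPowCofreeMkTorsion S ρ k t) = ζ k ^ (PadicInt.toZModPow k (w s t)).val)
    (k : ℕ) (a b : ↥(AddSubgroup.torsionBy (Cofree ρ ↥(padicCoeffField S)) ((p ^ (k + 1) : ℕ) : ℤ))) :
    ePk k ((cofreeTorsionPow S ρ k).hom a) ((cofreeTorsionPow S ρ k).hom b) = ePk (k + 1) a b ^ p := by
  haveI : NeZero (p ^ k) := ⟨pow_ne_zero k (Fact.out : p.Prime).ne_zero⟩
  obtain ⟨s, rfl⟩ := divPowCofreeMkTorsion_surjective S ρ (k + 1) a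
  obtain ⟨t, rfl⟩ := divPowCofreeMkTorsion_surjective S ρ (k + 1) b
  rw [cofreeTorsionPow_divPowCofreeMkTorsion, cofreeTorsionPow_divPowCofreeMkTorsion, hePk, hePk, ← pow_mul', pow_mul, hζsucc k]
  refine (pow_eq_pow_val (hζ k).pow_eq_one (PadicInt.toZModPow k (w s t)) _ ?_).symm
  rw [ZMod.natCast_val, ← PadicInt.zmod_cast_comp_toZModPow k (k + 1) (Nat.le_succ k)]
  rfl

end Rho

/-! ## §4 `p = 2`, the `AwayPins.hlocdS` currency -/

section AtPrimeTwo

/-- **H4. `ℚ/ℤ` arithmetic**: `(2V)/2^{k+1} = V/2^k` for `V ∈ ℤ/2^k` read as `2V ∈ ℤ/2^{k+1}`. [folklore] -/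
theorem addCircle_val_mul_two (k : ℕ) (V : ZMod (2 ^ k)) :
    (((V.val * 2 : ℕ)) : ZMod (2 ^ (k + 1))).val • ((((2 : ℚ) ^ (k + 1))⁻¹ : ℚ) : AddCircle (1 : ℚ)) =
      V.val • ((((2 : ℚ) ^ k)⁻¹ : ℚ) : AddCircle (1 : ℚ)) := by
  have hval : (((V.val * 2 : ℕ)) : ZMod (2 ^ (k + 1))).val = V.val * 2 := by
    rw [ZMod.val_natCast]
    exact Nat.mod_eq_of_lt (by rw [pow_succ]; exact Nat.mul_lt_mul_of_lt_of_le (ZMod.val_lt V) le_rfl two_pos)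
  rw [hval, ← AddCircle.coe_nsmul, ← AddCircle.coe_nsmul]
  congr 1
  rw [nsmul_eq_mul, nsmul_eq_mul, pow_succ]
  push_cast
  field_simp

variable (S : Set (PadicAlgCl 2)) (κ : ZpExtension ℚ 2) (ρ : FramedGaloisRep ℚ ↥(padicCoeffIntegers S) 2)
  (ePk : ∀ k : ℕ, ↥(AddSubgroup.torsionBy (Cofree ρ ↥(padicCoeffField S)) ((2 ^ k : ℕ) : ℤ)) →
    ↥(AddSubgroup.torsionBy (Cofree ρ ↥(padicCoeffField S)) ((2 ^ k : ℕ) : ℤ)) → AlgebraicClosure ℚ)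
  (hμPk : ∀ k a b, ePk k a b ^ (2 ^ k) = 1)
  (hadd₁Pk : ∀ k a₁ a₂ b, ePk k (a₁ + a₂) b = ePk k a₁ b * ePk k a₂ b)
  (hadd₂Pk : ∀ k a b₁ b₂, ePk k a (b₁ + b₂) = ePk k a b₁ * ePk k a b₂)
  (hgalPk : ∀ k (σ : absoluteGaloisGroup ℚ) (a b : ↥(AddSubgroup.torsionBy (Cofree ρ ↥(padicCoeffField S)) ((2 ^ k : ℕ) : ℤ))),
    σ • ePk k a b = ePk k (cofreeTorsionGaloisModule S ρ _ σ a) (cofreeTorsionGaloisModule S ρ _ σ b))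
  (htower : ∀ k (a b : ↥(AddSubgroup.torsionBy (Cofree ρ ↥(padicCoeffField S)) ((2 ^ (k + 1) : ℕ) : ℤ))),
    ePk k ((cofreeTorsionPow S ρ k).hom a) ((cofreeTorsionPow S ρ k).hom b) = ePk (k + 1) a b ^ 2)
  (w : HeightOneSpectrum (𝓞 ℚ)) (k : ℕ)
  (ι : (cofreeTorsionGaloisModule S ρ ((2 ^ k : ℕ) : ℤ)).toTopRep ⟶ (cofreeTorsionGaloisModule S ρ ((2 ^ (k + 1) : ℕ) : ℤ)).toTopRep)
  (hι : ∀ b, ((ι.hom b : ↥(AddSubgroup.torsionBy (Cofree ρ ↥(padicCoeffField S)) ((2 ^ (k + 1) : ℕ) : ℤ))) : Cofree ρ ↥(padicCoeffField S)) =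
    (b : Cofree ρ ↥(padicCoeffField S)))

set_option maxHeartbeats 1600000 in
include hμPk hadd₂Pk htower hι in
/-- **H7 in the `AwayPins.hlocdS` currency** (`p = 2`): for a pin class `red_{2^{k+1}} x'`, a local class `y ∈ H¹(U_{m,w}, A_ρ[2^k]|)` and its
image `ι_* y` at level `2^{k+1}`, the two value pins agree in `ℚ/ℤ`: `⟨red_{2^{k+1}}x', ι_*y⟩_{m,2^{k+1}}/2^{k+1} = ⟨red_{2^k}x', y⟩_{m,2^k}/2^k`
— the `k`-step of the glue of `locdS` (GLUE-SPEC-g18 T2(b) item (b)). -/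
theorem rhoAwayValue_incl_succ (m : ℕ) (x' : H1 (FramedGaloisRep.toGaloisRep ρ) (κ.layerSubgroup m)) (y : Dlev S κ ρ w m k) :
    (layerPairingOf (cofreeTorsionGaloisModule S ρ ((2 ^ (k + 1) : ℕ) : ℤ)) (2 ^ (k + 1)) (ePk (k + 1)) (hμPk (k + 1)) (hadd₁Pk (k + 1))
        (hadd₂Pk (k + 1)) (hgalPk (k + 1)) κ w m (reduceH1CofreePkTorsion S ρ (k + 1) (κ.layerSubgroup m) x')
        (cohomologyMap (subgroupRepMap (Y := localRepOf (cofreeTorsionGaloisModule S ρ ((2 ^ (k + 1) : ℕ) : ℤ)) w)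
          (TopRep.ofHom (ι.hom.restrictField (w.adicCompletion ℚ))) (layerGroup κ w m)) 1 y)).val •
        ((((2 : ℚ) ^ (k + 1))⁻¹ : ℚ) : AddCircle (1 : ℚ)) =
      (layerPairingOf (cofreeTorsionGaloisModule S ρ ((2 ^ k : ℕ) : ℤ)) (2 ^ k) (ePk k) (hμPk k) (hadd₁Pk k) (hadd₂Pk k) (hgalPk k) κ w m
        (reduceH1CofreePkTorsion S ρ k (κ.layerSubgroup m) x') y).val • ((((2 : ℚ) ^ k)⁻¹ : ℚ) : AddCircle (1 : ℚ)) := by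
  have h := rhoLayerPairingOf_incl_succ S ρ ePk hμPk hadd₁Pk hadd₂Pk hgalPk htower κ w k ι hι m x' y
  rw [h]
  exact addCircle_val_mul_two k _

include hι in
/-- **B7. `j_{m,k+1} ∘ ι_* = j_{m,k}`** on `H¹(U_{m,w}, A_ρ[2^k]|)` (restriction commutes with the coefficient map; `A_ρ[2^k] ⊆ A_ρ[2^{k+1}] ⊆ A_ρ`). -/
theorem jAway_incl (m : ℕ) (y : Dlev S κ ρ w m k) :
    jAway S κ ρ w m (k + 1)
        (cohomologyMap (subgroupRepMap (Y := localRepOf (cofreeTorsionGaloisModule S ρ ((2 ^ (k + 1) : ℕ) : ℤ)) w)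
          (TopRep.ofHom (ι.hom.restrictField (w.adicCompletion ℚ))) (layerGroup κ w m)) 1 y) =
      jAway S κ ρ w m k y := by
  rw [jAway_apply, jAway_apply, resLe_cohomologyMap_subgroupRepMap,
    cohomologyMap_comp_apply_of_eq _ _ (subgroupRepMap (Y := localRepOf (cofreeGaloisModule S ρ) w)
      (cofreeTorsionLocalInclusion S ρ ((2 ^ k : ℕ) : ℤ) w) (kerGroup κ w)) (fun b => hι b)]

variable (S₀ : Finset (HeightOneSpectrum (𝓞 ℚ))) (W : WeierstrassCurve ℚ) [W.IsElliptic] (γ : absoluteGaloisGroup ℚ) (n : ℕ)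
  (Θ : ∀ v : HeightOneSpectrum (𝓞 ℚ), ((2 : ℕ) : 𝓞 ℚ) ∈ v.asIdeal → (Cofree ρ ↥(padicCoeffField S) ≃+ (Fin n → ↥(W.geomPrimaryTorsion 2))))
  (hΘ : ∀ v hv (δ : absoluteGaloisGroup (v.adicCompletion ℚ)) m i,
    Θ v hv (resGalOfEmb (closureEmb (K := ℚ) (v.adicCompletion ℚ)) δ • m) i = resGalOfEmb (closureEmb (K := ℚ) (v.adicCompletion ℚ)) δ • Θ v hv m i)
  (I : Kato2004.IwasawaH1DataCoeff (FramedGaloisRep.toGaloisRep ρ) 2 κ γ)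
  (Sg : AddSubgroup (subgroupH1 κ.kerSubgroup (Cofree ρ ↥(padicCoeffField S)))) [Module ↥(padicCoeffIntegers S) ↥Sg]
  (π : OnePairPins S W κ γ S₀ n ρ Θ hΘ I Sg) [∀ w : ↥S₀, Module ℤ_[2] (Dloc S κ ρ (w : HeightOneSpectrum (𝓞 ℚ)))]

set_option maxHeartbeats 1600000 in
-- the binder block of `AwayPins` needs more than the default budget (as in `…OfParts2`)
/-- **N1. NECESSITY — H7 on pin classes follows from ANY `πₐ : AwayPins π`** (so no frame can dodge it, and the split stubs S1⊕ / EH / S4₂ / S4₀,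
which BIND `πₐ`, get every `k`-compatibility of the pin values for free — only the glue T2, which CONSTRUCTS `πₐ`, needs `htower`):
for any level-raising map `ιl` under which `j` is invariant, the two value pins of `hlocdS` agree. -/
theorem AwayPins.value_incl_compat (πₐ : AwayPins S κ ρ S₀ W γ n Θ hΘ I Sg π) (w : ↥S₀)
    (c : Cosets κ (w : HeightOneSpectrum (𝓞 ℚ))) (m : ℕ) (hm : nfl (w : HeightOneSpectrum (𝓞 ℚ)) ≤ m) (k : ℕ) (x : I.H)
    (ιl : Dlev S κ ρ w m k → Dlev S κ ρ w m (k + 1)) (hj : ∀ y, jAway S κ ρ w m (k + 1) (ιl y) = jAway S κ ρ w m k y)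
    (y : Dlev S κ ρ w m k) :
    (layerPairingOf (cofreeTorsionGaloisModule S ρ ((2 ^ (k + 1) : ℕ) : ℤ)) (2 ^ (k + 1)) (π.ePk (k + 1)) (π.hμPk (k + 1))
        (π.hadd₁Pk (k + 1)) (π.hadd₂Pk (k + 1)) (π.hgalPk (k + 1)) κ w m
        (reduceH1CofreePkTorsion S ρ (k + 1) (κ.layerSubgroup m)
          (conjMap (FramedGaloisRep.toGaloisRep ρ).toTopRep (κ.layerSubgroup m) c.out 1 (I.proj m x))) (ιl y)).val •
        ((((2 : ℚ) ^ (k + 1))⁻¹ : ℚ) : AddCircle (1 : ℚ)) =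
      (layerPairingOf (cofreeTorsionGaloisModule S ρ ((2 ^ k : ℕ) : ℤ)) (2 ^ k) (π.ePk k) (π.hμPk k) (π.hadd₁Pk k) (π.hadd₂Pk k)
        (π.hgalPk k) κ w m
        (reduceH1CofreePkTorsion S ρ k (κ.layerSubgroup m)
          (conjMap (FramedGaloisRep.toGaloisRep ρ).toTopRep (κ.layerSubgroup m) c.out 1 (I.proj m x))) y).val •
        ((((2 : ℚ) ^ k)⁻¹ : ℚ) : AddCircle (1 : ℚ)) :=
  (πₐ.hlocdS w c m hm (k + 1) x (ιl y)).symm.trans ((congrArg (πₐ.locdS x w c) (hj y)).trans (πₐ.hlocdS w c m hm k x y))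

end AtPrimeTwo

end Summit.BirchSwinnertonDyer.BirchSwinnertonDyer.Cruxes.ResidualThetaCountLowerPureAtTwo.SideaK1G18

end
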